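import Summits.ValiantsHypothesis.ValiantsHypothesis.Theses.TwoAdicLadder
import Literature.Computability.AlgebraicComplexity.RazElusiveGeneralRouteProofs

/-!
# TwoAdicLadder — crux `TwoIntegralNormalisation` (stmt-ValiantsHypothesis-5947), line `birth`:
# what the crux needs from the load-bearing stub `stub_halfElim`

Route `ValiantsHypothesis/TwoAdicLadder`, crux `TwoIntegralNormalisation` (TIN), registered line
`Cruxes/TwoIntegralNormalisation/Lines/birth.lean` with stubs `stub_algConst` (LANDED,
`TwoAdicLadderTwoIntegralNormalisationAlgConst.lean`), `stub_chainRingReduction` (LANDED,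
`TwoAdicLadderTwoIntegralNormalisationChainRingReduction.lean`) and the open, load-bearing
`stub_halfElim` (uniform elimination of division by `2` for the permanent).

This file records, sorry-free, how the crux depends on the remaining stub:

* `twoIntegralNormalisation_of_halfElim` — the registered (UNIFORM) stub `stub_halfElim`, together
  with the statements of the two landed stubs (taken as explicit hypotheses `hA`, `hC`, discharged
  by `stub_algConst` / `stub_chainRingReduction` of the sibling files, so that this file does not
  import them), gives the crux.
* `twoIntegralNormalisation_of_halfElimGlobal` — a WEAKER hypothesis already suffices: the GLOBAL
  form `HalfElimGlobal` ("if `per` has polynomial-size circuits over number fields then it has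
  polynomial-size circuits over the local rings `𝓞_(𝔭)`, `𝔭 ∣ 2`, eventually"), whose hypothesis is
  the conclusion of `stub_algConst`.
* `halfElimGlobal_of_halfElim` — the registered uniform stub implies the global form.
* `halfElimGlobal_of_valiantsHypothesis` — the global form is implied by `VP ≠ VNP` (its
  hypothesis puts `per` in `VP_ℂ` by embedding the number field into `ℂ`), i.e. it "cannot fail
  unless the summit does", exactly like the crux; the registered uniform `stub_halfElim`
  (`∀ n s`, one exponent `d`: `L_{𝓞_(𝔭)}(per_n) ≤ (L_K(per_n) + n + 2)^d` at EVERY `n`) is a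
  genuinely stronger structural statement (a polynomial relation between the `2`-integral and the
  number-field complexity of the permanent at every `n`), not implied by `VP ≠ VNP` by this argument.

Calibration for the planner (census of this seat): the line can be re-registered with the
VH-implied `HalfElimGlobal` in place of `stub_halfElim` without touching the landed stubs
(`TwoIntegralNormalisation_of` becomes `twoIntegralNormalisation_of_halfElimGlobal stub_algConst
stub_chainRingReduction`).
Honest framing: bookkeeping around an OPEN stub; neither `stub_halfElim` nor the crux nor
VP ≠ VNP is proved here.
-/

noncomputable section

open MvPolynomial

-- the summit and the problem share the name `ValiantsHypothesis` (D-0017 single-conjunct layout)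
set_option linter.dupNamespace false

namespace Summit.ValiantsHypothesis.ValiantsHypothesis.Theorems.TwoAdicLadder.TwoIntegralNormalisation

open Summit.ValiantsHypothesis.ValiantsHypothesis.Theses.TwoAdicLadder
open Literature.Computability.AlgebraicComplexity

/-- Envelope bookkeeping: for `n ≥ 2`, `n^a + a + n + 2 ≤ n^(a+3)`. [folklore] -/
theorem envelope_bound (a n : ℕ) (hn : 2 ≤ n) : n ^ a + a + n + 2 ≤ n ^ (a + 3) := by
  have h1 : a ≤ n ^ a := (a.lt_two_pow_self).le.trans (Nat.pow_le_pow_left hn a)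
  have h2 : 1 ≤ n ^ a := Nat.one_le_pow _ _ (by omega)
  have h3 : n + 4 ≤ n ^ 3 := by
    have h : 2 * 2 * n ≤ n * n * n := Nat.mul_le_mul (Nat.mul_le_mul hn hn) le_rfl
    calc n + 4 ≤ 2 * 2 * n := by omega
      _ ≤ n * n * n := h
      _ = n ^ 3 := by ring
  have h4 : n + 2 ≤ (n + 2) * n ^ a := by
    simpa using Nat.mul_le_mul_left (n + 2) h2
  calc n ^ a + a + n + 2 ≤ n ^ a + n ^ a + (n + 2) * n ^ a := by omega
    _ = (n + 4) * n ^ a := by ring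
    _ ≤ n ^ 3 * n ^ a := Nat.mul_le_mul_right _ h3
    _ = n ^ (a + 3) := by ring

/-- **The global form of `1/2`-elimination suffices for the crux.** If polynomial-size circuits
for `per_n` over number fields (one exponent `a`, every `n`) yield polynomial-size circuits over
some local ring `𝓞_(𝔭) = Localization.AtPrime 𝔭`, `2 ∈ 𝔭`, of some number field, for all large
`n` (hypothesis `h` = `HalfElimGlobal`, stated inline), then `TwoIntegralNormalisation` holds: the
number-field circuits come from `hA` (the statement of the landed `stub_algConst`), and the
`𝓞_(𝔭)`-circuits are transported for free along the reduction maps `𝓞_(𝔭) → R` onto admissible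
rings of every precision (`hC` = the statement of the landed `stub_chainRingReduction`; tree
`complexity_map_le`, `map_perPoly`). [folklore] -/
theorem twoIntegralNormalisation_of_halfElimGlobal
    (hA : IsPComputable (fun n => perPoly (Fin n) ℂ) →
      ∃ a : ℕ, ∀ n : ℕ, ∃ (K : Type) (_ : Field K) (_ : NumberField K),
        complexity (perPoly (Fin n) K) ≤ n ^ a + a)
    (hC : ∀ (K : Type) [Field K] [NumberField K] (P : Ideal (NumberField.RingOfIntegers K))
      [P.IsPrime], (2 : NumberField.RingOfIntegers K) ∈ P → ∀ k : ℕ,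
        ∃ (R : Type) (_ : CommRing R) (_ : Fintype R),
          IsPrincipalIdealRing R ∧ IsNilpotent (2 : R) ∧ (2 : R) ^ k ≠ 0 ∧
          Nonempty (Localization.AtPrime P →+* R))
    (h : (∃ a : ℕ, ∀ n : ℕ, ∃ (K : Type) (_ : Field K) (_ : NumberField K),
            complexity (perPoly (Fin n) K) ≤ n ^ a + a) →
          ∃ b : ℕ, ∀ᶠ n in Filter.atTop, ∃ (K' : Type) (_ : Field K') (_ : NumberField K')
            (P : Ideal (NumberField.RingOfIntegers K')) (_ : P.IsPrime),
            (2 : NumberField.RingOfIntegers K') ∈ P ∧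
            complexity (perPoly (Fin n) (Localization.AtPrime P)) ≤ n ^ b) :
    TwoIntegralNormalisation := by
  intro hP
  obtain ⟨b, hb⟩ := h (hA hP)
  refine ⟨b, ?_⟩
  filter_upwards [hb] with n hn
  intro k
  obtain ⟨K', hF, hNF, P, hP, h2P, hle⟩ := hn
  obtain ⟨R, hR, hRf, hPIR, hnil, hne, ⟨φ⟩⟩ := @hC K' hF hNF P hP h2P k
  refine ⟨R, hR, hRf, hPIR, hnil, hne, ?_⟩
  have hmap := ArithCircuit.complexity_map_le φ (perPoly (Fin n) (Localization.AtPrime P))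
  rw [map_perPoly] at hmap
  exact hmap.trans hle

/-- **The registered uniform stub implies the global form**: from one exponent `d` with
`L_{𝓞_(𝔭)}(per_n) ≤ (s + n + 2)^d` whenever `L_K(per_n) ≤ s`, polynomial number-field circuits of
size `n^a + a` give `𝓞_(𝔭)`-circuits of size `(n^a + a + n + 2)^d ≤ n^((a+3)d)` for `n ≥ 2`
(`envelope_bound`). [folklore] -/
theorem halfElimGlobal_of_halfElim
    (h : ∃ d : ℕ, ∀ (n s : ℕ) (K : Type) [Field K] [NumberField K],
      complexity (perPoly (Fin n) K) ≤ s →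
        ∃ (K' : Type) (_ : Field K') (_ : NumberField K')
          (P : Ideal (NumberField.RingOfIntegers K')) (_ : P.IsPrime),
          (2 : NumberField.RingOfIntegers K') ∈ P ∧
          complexity (perPoly (Fin n) (Localization.AtPrime P)) ≤ (s + n + 2) ^ d) :
    (∃ a : ℕ, ∀ n : ℕ, ∃ (K : Type) (_ : Field K) (_ : NumberField K),
        complexity (perPoly (Fin n) K) ≤ n ^ a + a) →
      ∃ b : ℕ, ∀ᶠ n in Filter.atTop, ∃ (K' : Type) (_ : Field K') (_ : NumberField K')
        (P : Ideal (NumberField.RingOfIntegers K')) (_ : P.IsPrime),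
        (2 : NumberField.RingOfIntegers K') ∈ P ∧
        complexity (perPoly (Fin n) (Localization.AtPrime P)) ≤ n ^ b := by
  rintro ⟨a, ha⟩
  obtain ⟨d, hd⟩ := h
  refine ⟨(a + 3) * d, ?_⟩
  filter_upwards [Filter.eventually_ge_atTop 2] with n hn
  obtain ⟨K, hFK, hNK, hK⟩ := ha n
  obtain ⟨K', hF, hNF, P, hP, h2P, hle⟩ := @hd n (n ^ a + a) K hFK hNK hK
  refine ⟨K', hF, hNF, P, hP, h2P, ?_⟩
  refine hle.trans ?_
  calc (n ^ a + a + n + 2) ^ d ≤ (n ^ (a + 3)) ^ d := Nat.pow_le_pow_left (envelope_bound a n hn) d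
    _ = n ^ ((a + 3) * d) := (pow_mul n (a + 3) d).symm

/-- **The registered stub `stub_halfElim` closes the crux, given the two landed stubs**: with
`hA` / `hC` the statements of `stub_algConst` / `stub_chainRingReduction` (both landed) and `h`
the registered signature of `stub_halfElim` verbatim, `TwoIntegralNormalisation` follows — the
line `birth` rests on the uniform `1/2`-elimination only. [folklore] -/
theorem twoIntegralNormalisation_of_halfElim
    (hA : IsPComputable (fun n => perPoly (Fin n) ℂ) →
      ∃ a : ℕ, ∀ n : ℕ, ∃ (K : Type) (_ : Field K) (_ : NumberField K),
        complexity (perPoly (Fin n) K) ≤ n ^ a + a)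
    (hC : ∀ (K : Type) [Field K] [NumberField K] (P : Ideal (NumberField.RingOfIntegers K))
      [P.IsPrime], (2 : NumberField.RingOfIntegers K) ∈ P → ∀ k : ℕ,
        ∃ (R : Type) (_ : CommRing R) (_ : Fintype R),
          IsPrincipalIdealRing R ∧ IsNilpotent (2 : R) ∧ (2 : R) ^ k ≠ 0 ∧
          Nonempty (Localization.AtPrime P →+* R))
    (h : ∃ d : ℕ, ∀ (n s : ℕ) (K : Type) [Field K] [NumberField K],
      complexity (perPoly (Fin n) K) ≤ s →
        ∃ (K' : Type) (_ : Field K') (_ : NumberField K')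
          (P : Ideal (NumberField.RingOfIntegers K')) (_ : P.IsPrime),
          (2 : NumberField.RingOfIntegers K') ∈ P ∧
          complexity (perPoly (Fin n) (Localization.AtPrime P)) ≤ (s + n + 2) ^ d) :
    TwoIntegralNormalisation :=
  twoIntegralNormalisation_of_halfElimGlobal hA hC (halfElimGlobal_of_halfElim h)

/-- **Polynomial-size circuits for `per` over number fields put `per` in `VP_ℂ`**: embed the
number field into `ℂ` (Mathlib: a number field has an embedding into every algebraically closed
field of characteristic zero) and extend scalars for free (`complexity_map_le`, `map_perPoly`).
[cite: Burgisser2000, §4.1] -/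
theorem isPComputable_perPoly_complex_of_numberField
    (h : ∃ a : ℕ, ∀ n : ℕ, ∃ (K : Type) (_ : Field K) (_ : NumberField K),
      complexity (perPoly (Fin n) K) ≤ n ^ a + a) :
    IsPComputable (fun n => perPoly (Fin n) ℂ) := by
  obtain ⟨a, ha⟩ := h
  refine ⟨a, fun n => ?_⟩
  obtain ⟨K, hFK, hNK, hK⟩ := ha n
  obtain ⟨φ⟩ := (inferInstance : Nonempty (K →+* ℂ))
  have hmap := ArithCircuit.complexity_map_le φ (perPoly (Fin n) K)
  rw [map_perPoly] at hmap
  exact hmap.trans hK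

/-- **The global form of `1/2`-elimination is implied by `VP ≠ VNP`** (it "cannot fail unless the
summit does"): under `VP_ℂ ≠ VNP_ℂ` the permanent is not p-computable over `ℂ`
(tree `isPComputable_perPoly_complex_iff`), so it has no polynomial-size circuits over number
fields either (`isPComputable_perPoly_complex_of_numberField`), and the hypothesis of
`HalfElimGlobal` is void. The registered UNIFORM `stub_halfElim` is not obtained this way.
[cite: Burgisser2000, §4.1] -/
theorem halfElimGlobal_of_valiantsHypothesis (hVH : _root_.ValiantsHypothesis) :
    (∃ a : ℕ, ∀ n : ℕ, ∃ (K : Type) (_ : Field K) (_ : NumberField K),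
        complexity (perPoly (Fin n) K) ≤ n ^ a + a) →
      ∃ b : ℕ, ∀ᶠ n in Filter.atTop, ∃ (K' : Type) (_ : Field K') (_ : NumberField K')
        (P : Ideal (NumberField.RingOfIntegers K')) (_ : P.IsPrime),
        (2 : NumberField.RingOfIntegers K') ∈ P ∧
        complexity (perPoly (Fin n) (Localization.AtPrime P)) ≤ n ^ b := by
  intro h
  have hP := isPComputable_perPoly_complex_of_numberField h
  exact absurd (isPComputable_perPoly_complex_iff.1 hP) hVH

end Summit.ValiantsHypothesis.ValiantsHypothesis.Theorems.TwoAdicLadder.TwoIntegralNormalisation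

end
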